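import Summits.BirchSwinnertonDyer.Rank1Residual.X5.TwoAdicTargetsEnd
import Summits.BirchSwinnertonDyer.Rank1Residual.X5.TwoAdicTargetsMC
import Literature.NumberTheory.EllipticCurves.Wuthrich2014.ShaBoundProofs
import HarnessLib

/-!
# Class O1 (X5, `p = 2`, non-CM): the EISENSTEIN direction of the main conjecture at `2`, typed in
# the right orientation, with its proved consequence — the LOWER half `MissingLowerBoundAt W 2`

HONEST FRAMING (cell `b2b-bsdres`, run/shared/lean/b2b/bsd-rank1-residual/, verbatim in every
file): the goal of the cell is to DELETE the COMBINATION-SHAPED residual classes of the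
Birch–Swinnerton-Dyer formula for ALL analytic-rank `≤ 1` elliptic curves over `ℚ` — "full BSD
formula for every rank `≤ 1` curve in class `C`" assembled STRICTLY from published theorems — so
that the rank-`≤ 1` remainder becomes exactly the CONSTRUCTION-SHAPED classes, which are TYPED
(missing-input `Prop`s), NOT attempted. This is not "finishing BSD". Research routes; no claim
beyond stated classes; census output = EVIDENCE, never a Literature fact; nothing here is booked;
no mark of RESIDUAL-MAP §I moves.

Unit `b2b-bsdres-cc-typer-4` (lane CLASS-CLOSURE, class O1), gen 3. ONE typed target
(`@[conjecture] def`, Summits-side, nothing asserted) + PROVED bookkeeping. Why this file exists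
(statement-level finding, gen 3, kernel-checked in `X5/TwoAdicTargetsAlpha.lean`,
`missingUpperBoundAt_two_of_mainConjectureLowerDivisibilityAtTwoOrd`): the cell's typed E2 residue
`O1.MainConjectureLowerDivisibilityAtTwoOrd W` ("`∃ g ∈ char_Λ X, ι g = ϖ · L₂(f, α)`", i.e.
`(𝓛₂^{MSD}(E)) ⊆ char_Λ X`) is KATO's direction — Skinner–Urban 2014 p. 43, proof of Thm. 3.6.4:
"By Kato's Theorem 3.5.6 `(𝓛^Σ_f) ⊆ Ch_{ℚ_∞}(f)`" — and on a rank-`0` good-ordinary-`2` curve it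
yields the UPPER bound `ord₂ #Ш ≤ ord₂ #Ш_an`; the class-level source of the LOWER half
`MissingLowerBoundAt W 2` (`ord₂ #Ш_an ≤ ord₂ #Ш`, PLAN F4) must be the opposite inclusion
`Ch_{ℚ_∞}(f) ⊆ (𝓛_f)` — the one Skinner–Urban obtain from Eisenstein congruences on `U(2,2)`
(Cor. 3.6.2–3.6.3, `p` odd) — which the tree did not have at `2`. It is typed here.

* **`O1.MainConjectureEisensteinDivisibilityAtTwo W` (`@[conjecture]`)** — for the cyclotomic
  `ℤ₂`-extension, IF `E` is good ordinary at `2` (guard `IsOrdinaryAt W 2`, o1 refuter R1), the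
  newform `f` at level `N_E`, the Néron period ratio `ϖ` (`ϖ · Ω_E = Ω⁺_f`), every dual datum `D` and
  every generator `f_X` of `char_Λ X(E/ℚ_∞)`: `ι f_X = ι h · (ϖ · L₂(f, α))` for some `h ∈ Λ`, i.e.
  `char_Λ X ⊆ (𝓛₂^{MSD}(E))` ("`𝓛 ∣ char X`"). = the Eisenstein half of the cell's
  `MazurMainConjecture W 2` (`…_of_mazurMainConjecture`, proved); with the Kato-Néron half
  `MainConjectureLowerDivisibilityAtTwoOrd` and `X` torsion it gives back the guarded
  `MazurMainConjecture W 2` (`mazurMainConjecture_two_of_kato_of_eisenstein`, proved). NOTHING in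
  print or announced at `p = 2` (S–U p. 1 l. 8 "Let `p` be an odd prime"; Wan, CGS, BCS, Keller–Yin
  keep `p` odd). OPEN; nothing asserted.
* **`lowerBound_two_of_eisensteinDivisibility` (PROVED)** — the LOWER twin of the chain G11a/G11a′:
  good ordinary `2`, `L(E,1) ≠ 0`, GZK (finiteness of `E(ℚ)`, `Ш`, hence of `Sel_{2^∞}`), Greenberg
  4.1 AT `2` (`hEC`, in print), `X` torsion, and a rational-normaliser Eisenstein datum
  `ι f_X = ι h · (ϖ′ · L₂(f, α))` with `ord₂ ϖ ≤ ord₂ ϖ′ + k` ⇒ `∃ q, #Ш_an = q ∧ ord₂ q ≤ ord₂ #Ш + k`: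
  `f_X(0) · #E(ℚ)(2)² ~ 2^{ord₂∏c} #Ẽ(𝔽₂)(2)² #Sel` and `ι f_X(0) = h(0) ϖ′ (1 − α⁻¹)² [0]⁺_f` give
  `ord₂ h(0) + ord₂ ϖ′ + ord₂ [0]⁺_f + 2 ord₂ #E(ℚ)_tors = ord₂ ∏c + ord₂ #Ш`, `ord₂ h(0) ≥ 0`.
* **`missingLowerBoundAt_two_of_eisenstein` (PROVED)** — on O1-go ∧ r0 the typed Eisenstein half
  (at `ϖ′ = ϖ`) delivers the SHARP lower half `MissingLowerBoundAt W 2`, granted Greenberg 4.1 at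
  `2`, modularity, GZK and `X` torsion (Kato 17.4 (1) at `2`, in print); no image hypothesis, no
  period-unit input. So on a rank-`0` good-ordinary-`2` residue class the CLASS-LEVEL closing inputs
  are exactly the two halves of the main conjecture at `2` in Néron normalisation (assembled in
  `X5/TwoAdicTargetsAlphaEnd.lean`); per pair the lower half stays a certificate.

References: [SkinnerUrban2014] Conj. 3.6.8 (p. 45), Thm. 3.6.4 and its proof (p. 43), Cor.
3.6.2–3.6.3 (p. 42); [GreenbergLNM1716] Thm. 4.1 (p. 102); [Kato2004Asterisque] Thm. 17.4 (p. 273);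
[Miller2011LMS] Def. 1.1; [MazurTateTeitelbaum1986Invent] §I.14 (14.3).
-/

set_option autoImplicit false

noncomputable section

open scoped Classical MatrixGroups ModularForm

open CongruenceSubgroup WeierstrassCurve Literature.NumberTheory.EllipticCurves
  Literature.NumberTheory.EllipticCurves.ModularForms
  Literature.NumberTheory.EllipticCurves.Wuthrich2014
  Literature.NumberTheory.EllipticCurves.Rank1Residual
  Literature.NumberTheory.EllipticCurves.Rank1Residual.Typed
  Summit.BirchSwinnertonDyer.BirchSwinnertonDyer.Theorems.Rank1ResidualX1Defs

namespace Summit.BirchSwinnertonDyer.Rank1Residual.X5.O1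

variable (W : WeierstrassCurve ℚ) [W.IsElliptic] [W.IsGloballyMinimal]

/-! ## §1 The Eisenstein direction at `2`, typed (guarded), and its relation to `MazurMainConjecture W 2` -/

/-- **E2 IRREDUCIBLE RESIDUE, LOWER HALF — the Eisenstein ("Skinner–Urban") direction of the
cyclotomic main conjecture AT a GOOD ORDINARY `2`, Néron normalisation: `char_Λ X(E/ℚ_∞) ⊆
(𝓛₂^{MSD}(E))`.** For the cyclotomic `ℤ₂`-extension (`κ` cyclotomic, `γ` a topological generator
matching the cyclotomic variable), IF `E` (globally minimal `W`) is good ordinary at `2`, then for the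
newform `f` at level `N_E`, the rational `ϖ` with `ϖ · Ω_E = Ω⁺_f`, every dual datum `D` and every
generator `f_X` of `char_Λ X`: `ι f_X = ι h · (ϖ · L₂(f, α))` for some `h ∈ Λ = ℤ₂⟦T⟧` (`ι : Λ ↪ ℚ₂⟦T⟧`).
This is the inclusion Skinner–Urban obtain at ODD `p` from the Eisenstein ideal of `U(2,2)`
(Cor. 3.6.2–3.6.3; combined with Kato's `(𝓛_f) ⊆ Ch_{ℚ_∞}(f)` in the proof of Thm. 3.6.4, p. 43) and
one half of Conj. 3.6.8 "`F_E` is principal and generated by `L_E`". On a rank-`0` curve it is the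
half that bounds `#Ш[2^∞]` from BELOW (`missingLowerBoundAt_two_of_eisenstein`). NOTHING in print or
announced at `p = 2` for a non-CM curve (S–U p. 1: "Let `p` be an odd prime"; every later ordinary
main conjecture keeps `p` odd). Guarded by `IsOrdinaryAt W 2` (o1 refuter R1: off the ordinary locus
`unitRoot W 2 = 0` and `L₂(f, 0) = 0`, where the unguarded statement would force `f_X = 0`). OPEN;
nothing asserted. [cite: SkinnerUrban2014, Conj. 3.6.8 (p. 45); Cor. 3.6.2–3.6.3 (p. 42) and proof of Thm. 3.6.4 (p. 43) (p odd; shape only; nothing asserted)] -/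
@[conjecture] def MainConjectureEisensteinDivisibilityAtTwo : Prop :=
  ∀ (κ : ZpExtension ℚ 2) (γ : Field.absoluteGaloisGroup ℚ),
      κ.IsCyclotomic → κ.IsTopGenerator γ → IsCyclotomicVariable 2 γ → IsOrdinaryAt W 2 →
    ∀ [NeZero (W.conductorNorm ℤ)] (f : CuspForm (Gamma0 (W.conductorNorm ℤ)) 2),
      IsNewformOf W f → ∀ (ϖ : ℚ), (ϖ : ℝ) * W.realPeriodRat = plusPeriod f →
    ∀ (D : W.SelmerDualData κ γ) (fE : IwasawaAlgebra 2), D.charIdeal = Ideal.span {fE} →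
      ∃ h : IwasawaAlgebra 2, iwasawaToPowerSeries 2 fE =
        iwasawaToPowerSeries 2 h *
          (PowerSeries.C (ϖ : ℚ_[2]) * padicLFunction f (unitRoot W 2 : ℚ_[2]))

/-- The guarded main conjecture gives the Eisenstein half: `char X = (g)`, `ι g = ϖ · L₂`; a second
generator `f_X` is `u · g` for a unit `u` (`Λ` a domain), so `ι f_X = ι u · (ϖ · L₂)`. Bookkeeping.
[cite: SkinnerUrban2014, Conj. 3.6.8 (p. 45)] -/
theorem mainConjectureEisensteinDivisibilityAtTwo_of_mazurMainConjecture
    (h : IsOrdinaryAt W 2 → MazurMainConjecture W 2) :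
    MainConjectureEisensteinDivisibilityAtTwo W := by
  intro κ γ hκ hγ hγ' hord _ f hf ϖ hϖ D fE hchar
  obtain ⟨-, g, hcharg, hι⟩ := h hord κ γ hκ hγ hγ' f hf ϖ hϖ D
  have hspan : Ideal.span ({fE} : Set (IwasawaAlgebra 2)) = Ideal.span {g} := by
    rw [← hchar, hcharg]
  obtain ⟨u, hu⟩ := Ideal.span_singleton_eq_span_singleton.mp hspan.symm
  refine ⟨(u : IwasawaAlgebra 2), ?_⟩
  rw [← hu, map_mul, hι, mul_comm]

omit [W.IsElliptic] in
/-- The guard is not cosmetic (as for the Kato-Néron half, `X5/TwoAdicTargetsMC.lean`): on the cells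
with `2 ∣ a₂` the item holds VACUOUSLY. [folklore] -/
theorem mainConjectureEisensteinDivisibilityAtTwo_of_two_dvd_frobeniusTrace
    (h2 : (2 : ℤ) ∣ W.frobeniusTrace 2) : MainConjectureEisensteinDivisibilityAtTwo W :=
  fun _ _ _ _ _ hord => absurd h2 hord.2

/-- **The two typed halves reassemble the guarded main conjecture at `2`.** Kato-Néron half
(`MainConjectureLowerDivisibilityAtTwoOrd`: `g ∈ char X = (f_X)`, `ι g = ϖ · L₂`) + Eisenstein half
(`ι f_X = ι h · ϖ · L₂ = ι (h · g)`) ⇒ `f_X = h · g = h · a · f_X`, so `h · a = 1` (`f_X ≠ 0`: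
`Module.charIdeal_ne_bot`), `a` is a unit and `char X = (g)`; with `X` torsion (`hX`; Kato 17.4 (1) at
`2`, in print) this is `MazurMainConjecture W 2` under the guard. Bookkeeping.
[cite: SkinnerUrban2014, proof of Thm. 3.6.4 (p. 43) (two inclusions ⇒ equality; shape)] -/
theorem mazurMainConjecture_two_of_kato_of_eisenstein
    (hX : ∀ (κ : ZpExtension ℚ 2) (γ : Field.absoluteGaloisGroup ℚ), κ.IsCyclotomic →
      κ.IsTopGenerator γ → IsCyclotomicVariable 2 γ → ∀ D : W.SelmerDualData κ γ, D.IsTorsion)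
    (hK : MainConjectureLowerDivisibilityAtTwoOrd W) (hE : MainConjectureEisensteinDivisibilityAtTwo W)
    (hord : IsOrdinaryAt W 2) : MazurMainConjecture W 2 := by
  intro κ γ hκ hγ hγ' _ f hf ϖ hϖ D
  haveI : (Module.charIdeal (IwasawaAlgebra 2) D.X).IsPrincipal := charIdeal_isPrincipal_holds 2 D.X
  obtain ⟨fE, hfE⟩ := Submodule.IsPrincipal.principal (Module.charIdeal (IwasawaAlgebra 2) D.X)
  have hchar : D.charIdeal = Ideal.span {fE} := hfE
  have hfE0 : fE ≠ 0 := by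
    intro h0
    refine Module.charIdeal_ne_bot (IwasawaAlgebra 2) D.X ?_
    change D.charIdeal = ⊥
    rw [hchar, h0]
    exact Ideal.span_singleton_eq_bot.mpr rfl
  obtain ⟨g, hg, hιg⟩ := hK κ γ hκ hγ hγ' hord f hf ϖ hϖ D
  obtain ⟨h, hιfE⟩ := hE κ γ hκ hγ hγ' hord f hf ϖ hϖ D fE hchar
  rw [hchar] at hg
  obtain ⟨a, ha⟩ := Ideal.mem_span_singleton'.mp hg
  -- `fE = h · g` by injectivity of `ι`
  have hfg : fE = h * g := iwasawaToPowerSeries_injective 2 (by rw [map_mul, hιg, hιfE])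
  -- `h · a = 1`
  have hha : h * a = 1 := by
    have h1 : (h * a) * fE = 1 * fE := by rw [one_mul, mul_assoc, ha, ← hfg]
    exact mul_right_cancel₀ hfE0 h1
  have haunit : IsUnit a := IsUnit.of_mul_eq_one_right h hha
  refine ⟨hX κ γ hκ hγ hγ' D, g, ?_, hιg⟩
  rw [hchar, ← ha, Ideal.span_singleton_mul_left_unit haunit]

/-! ## §2 The LOWER twin of the chain: an Eisenstein datum bounds `#Ш_an` by `#Ш` -/

/-- **Lower chain at `2` (PROVED).** Let `W` be globally minimal, good ordinary at `2` (`hord`),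
`L(E,1) ≠ 0` (`hL`); GZK (`hGZK`: `E(ℚ)` and `Ш` finite, `#Ш_an = t · #E(ℚ)² / ∏c_ℓ` with
`t = L(E,1)/Ω_E`); Greenberg Thm. 4.1 AT `2` (`hEC`, in print). Fix a cyclotomic datum, a newform
`f` of `E`, a dual datum `D` with `X` torsion (`hX`), the period ratio `ϖ` (`ϖ · Ω_E = Ω⁺_f`), a
non-zero rational `ϖ′` with `ord₂ ϖ ≤ ord₂ ϖ′ + k`, and an EISENSTEIN datum: every generator `f_X` of
`char_Λ X` satisfies `ι f_X = ι h · (ϖ′ · L₂(f, α))` for some `h ∈ Λ`. Then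
`∃ q, #Ш_an = q ∧ ord₂ q ≤ ord₂ #Ш + k`. Proof: `f_X(0) · #E(ℚ)(2)² = u · 2^{ord₂ ∏c} · #Ẽ(𝔽₂)(2)² ·
#Sel_{2^∞}(E/ℚ)` (Thm. 4.1 at `2`), `ι f_X(0) = h(0) · ϖ′ · (1 − α⁻¹)² · [0]⁺_f` (interpolation,
`constantCoeff_padicLFunction_unitRoot`), `1 − α⁻¹ ~ #Ẽ(𝔽₂)(2)` cancels, `#Sel = #Ш(2)`, so
`ord₂ h(0) + ord₂ ϖ′ + ord₂ [0]⁺_f + 2 ord₂ #E(ℚ)_tors = ord₂ ∏c + ord₂ #Ш` with `ord₂ h(0) ≥ 0`, and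
`ord₂ #Ш_an = ord₂ ϖ + ord₂ [0]⁺_f + 2 ord₂ #E(ℚ)_tors − ord₂ ∏c`.
[cite: GreenbergLNM1716, Thm. 4.1 (p. 102)] [cite: MazurTateTeitelbaum1986Invent, §I.14 (14.3)]
[cite: Miller2011LMS, Def. 1.1 and §1] -/
theorem lowerBound_two_of_eisensteinDivisibility (hEC : TwoAdicEulerCharRankZero W 0)
    (hGZK : rank_eq_analyticRank_of_analyticRank_le_one)
    (hord : IsOrdinaryAt W 2) (hL : W.entireLFunction 1 ≠ 0)
    {κ : ZpExtension ℚ 2} {γ : Field.absoluteGaloisGroup ℚ} {N : ℕ} [NeZero N]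
    {f : CuspForm (Gamma0 N) 2} (hκ : κ.IsCyclotomic) (hγ : κ.IsTopGenerator γ)
    (hγ' : IsCyclotomicVariable 2 γ) (hf : IsNewformOf W f) (D : W.SelmerDualData κ γ)
    (hX : D.IsTorsion) (ϖ : ℚ) (hϖ : (ϖ : ℝ) * W.realPeriodRat = plusPeriod f) {ϖ' : ℚ}
    (hϖ'0 : ϖ' ≠ 0) (k : ℕ) (hk : padicValRat 2 ϖ ≤ padicValRat 2 ϖ' + k)
    (hdiv : ∀ fE : IwasawaAlgebra 2, D.charIdeal = Ideal.span {fE} →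
      ∃ h : IwasawaAlgebra 2, iwasawaToPowerSeries 2 fE =
        iwasawaToPowerSeries 2 h *
          (PowerSeries.C (ϖ' : ℚ_[2]) * padicLFunction f (unitRoot W 2 : ℚ_[2]))) :
    ∃ q : ℚ, shaAn W = (q : ℂ) ∧ padicValRat 2 q ≤ (padicValNat 2 W.shaOrder : ℤ) + k := by
  -- Step 0: `t = ϖ · s = L(E,1)/Ω_E`, `s = [0]⁺_f ≠ 0`
  have hΩpos : 0 < W.realPeriodRat := W.realPeriodRat_pos_holds
  have hϖ0 : ϖ ≠ 0 := by
    rintro rfl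
    have hper : 0 < plusPeriod f := IsNewform0.plusPeriod_pos_holds hf.1 hf.coeffField_eq_bot
    rw [← hϖ, Rat.cast_zero, zero_mul] at hper
    exact lt_irrefl _ hper
  set s : ℚ := ratPlusSymbol f 0 with hs_def
  set t : ℚ := ϖ * s with ht_def
  have hLval : W.entireLFunction 1 = (((s : ℝ) * plusPeriod f : ℝ) : ℂ) := hf.entireLFunction_one_eq
  have hq : W.entireLFunction 1 / (W.realPeriodRat : ℂ) = ((t : ℚ) : ℂ) := by
    rw [hLval, ← hϖ, div_eq_iff (Complex.ofReal_ne_zero.mpr hΩpos.ne'), ht_def]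
    push_cast
    ring
  have hs0 : s ≠ 0 := by
    intro h0
    apply hL
    rw [hLval, h0]
    simp
  have hvt : padicValRat 2 t = padicValRat 2 ϖ + padicValRat 2 s := by
    rw [ht_def, padicValRat.mul hϖ0 hs0]
  -- Step 1: finiteness from GZK (rank 0): `E(ℚ)`, `Ш`, `Sel_{2^∞}(E/ℚ)` finite
  have hr : W.analyticRank = 0 := analyticRank_eq_zero_of_entireLFunction_one_ne_zero W hL
  obtain ⟨hmw, hE, hfin, hshaAn⟩ := shaAn_eq_of_L_one_div_eq hGZK W hL hq
  haveI := hE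
  haveI : Finite W.sha := hfin
  have hShapfin : Finite (AddCommGroup.primaryComponent W.sha 2) :=
    Finite.of_injective _ Subtype.val_injective
  have hSelfin : Finite (W.selmerGroupPInfty 2) := (W.finite_selmerGroupPInfty_iff 2).mpr ⟨hE, hShapfin⟩
  haveI := hSelfin
  haveI : Module.Finite (IwasawaAlgebra 2) D.X := D.module_finite_holds hγ
  -- Step 2: a generator `fE` of `char X` and the Eisenstein cofactor `h`
  haveI : (Module.charIdeal (IwasawaAlgebra 2) D.X).IsPrincipal := charIdeal_isPrincipal_holds 2 D.X
  obtain ⟨fE, hchar⟩ := Submodule.IsPrincipal.principal (Module.charIdeal (IwasawaAlgebra 2) D.X)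
  have hchar' : D.charIdeal = Ideal.span {fE} := hchar
  obtain ⟨h, hιfE⟩ := hdiv fE hchar'
  -- Step 3 (interpolation): `ι fE (0) = h(0) · ϖ′ · (1 - α⁻¹)² · s`
  set a : ℚ_[2] := ((unitRoot W 2 : ℤ_[2]) : ℚ_[2]) with ha
  set h0 : ℚ_[2] := ((PowerSeries.constantCoeff h : ℤ_[2]) : ℚ_[2]) with hh0
  have hfE0Q : ((PowerSeries.constantCoeff fE : ℤ_[2]) : ℚ_[2]) =
      h0 * ((ϖ' : ℚ_[2]) * ((1 - a⁻¹) ^ 2 * (s : ℚ_[2]))) := by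
    rw [← constantCoeff_iwasawaToPowerSeries 2 fE, hιfE, map_mul, map_mul,
      PowerSeries.constantCoeff_C, constantCoeff_padicLFunction_unitRoot hord hf, hh0,
      constantCoeff_iwasawaToPowerSeries 2 h]
  -- bridges `1 - α⁻¹ = u₂ · #Ẽ(𝔽₂)`, `#Ẽ(𝔽₂) = u₃ · #Ẽ(𝔽₂)(2)`
  obtain ⟨u₂, hu₂⟩ := exists_unit_one_sub_unitRoot_inv 2 W hord
  haveI : NeZero (2 : ℕ) := ⟨two_ne_zero⟩
  obtain ⟨u₃, hu₃⟩ := exists_unit_natCard_eq_mul_card_primaryComponent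
    ((integralModelInt W).map (Int.castRingHom (ZMod 2))).toAffine.Point 2
  set Np : ℚ_[2] := (Nat.card (AddCommGroup.primaryComponent
    ((integralModelInt W).map (Int.castRingHom (ZMod 2))).toAffine.Point 2) : ℚ_[2]) with hNp
  have hNcount : (W.reductionPointCount 2 : ℚ_[2]) = ((u₃ : ℤ_[2]) : ℚ_[2]) * Np := by
    rw [WeierstrassCurve.reductionPointCount, hNp]
    exact hu₃
  have hNp0 : Np ≠ 0 := by
    rw [hNp]
    exact_mod_cast Nat.card_pos.ne'
  have h1 : (1 - a⁻¹) = ((u₂ : ℤ_[2]) : ℚ_[2]) * ((u₃ : ℤ_[2]) : ℚ_[2]) * Np := by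
    rw [hu₂, hNcount, mul_assoc]
  have hsQ0 : (s : ℚ_[2]) ≠ 0 := by exact_mod_cast hs0
  have hϖ'Q0 : (ϖ' : ℚ_[2]) ≠ 0 := by exact_mod_cast hϖ'0
  have hU0 : ((u₂ : ℤ_[2]) : ℚ_[2]) * ((u₃ : ℤ_[2]) : ℚ_[2]) ≠ 0 :=
    mul_ne_zero (coe_units_ne_zero 2 u₂) (coe_units_ne_zero 2 u₃)
  have h20 : (2 : ℚ_[2]) ≠ 0 := two_ne_zero
  -- Step 4 (Greenberg's Thm. 4.1 AT 2, hypothesis `hEC`, slot `δ = 0`, for the generator `fE`)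
  obtain ⟨u₁, hu₁⟩ := hEC hord κ γ hκ hγ hγ' D hX fE hchar' hSelfin
  rw [add_zero, zpow_natCast] at hu₁
  -- Step 5 (the remaining bridges)
  obtain ⟨u₄, hu₄⟩ := exists_unit_torsionOrder_eq W 2
  obtain ⟨u₅, hu₅⟩ := exists_unit_natCard_eq_mul_card_primaryComponent W.sha 2
  have hSel : Nat.card (W.selmerGroupPInfty 2) = Nat.card (AddCommGroup.primaryComponent W.sha 2) :=
    W.natCard_selmerGroupPInfty_eq_natCard_primaryComponent_sha 2
  set v := padicValNat 2 W.tamagawaProduct with hv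
  set Tp : ℚ_[2] := (Nat.card (AddCommGroup.primaryComponent W.toAffine.Point 2) : ℚ_[2]) with hTp
  set Shp : ℚ_[2] := (Nat.card (AddCommGroup.primaryComponent W.sha 2) : ℚ_[2]) with hShp
  have hu₄' : (W.torsionOrder : ℚ_[2]) = ((u₄ : ℤ_[2]) : ℚ_[2]) * Tp := by
    rw [hu₄, hTp]
    congr 1
    exact_mod_cast natCard_primaryComponent_point_congr W 2 _ _
  have hSha : (W.shaOrder : ℚ_[2]) = ((u₅ : ℤ_[2]) : ℚ_[2]) * Shp := by
    rw [WeierstrassCurve.shaOrder, hShp]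
    exact hu₅
  have hSel' : (Nat.card (W.selmerGroupPInfty 2) : ℚ_[2]) = Shp := by rw [hShp, hSel]
  have hTp0 : Tp ≠ 0 := by rw [hTp]; exact_mod_cast Nat.card_pos.ne'
  have hShp0 : Shp ≠ 0 := by rw [hShp]; exact_mod_cast Nat.card_pos.ne'
  -- `fE(0) ≠ 0` (from Thm. 4.1: the right-hand side is non-zero), hence `h(0) ≠ 0`
  have hfE00 : ((PowerSeries.constantCoeff fE : ℤ_[2]) : ℚ_[2]) ≠ 0 := by
    intro h0'
    have := hu₁
    rw [h0', zero_mul, hSel'] at this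
    exact (mul_ne_zero (mul_ne_zero (mul_ne_zero (coe_units_ne_zero 2 u₁) (pow_ne_zero v h20))
      (pow_ne_zero 2 hNp0)) hShp0) this.symm
  have hh0ne : h0 ≠ 0 := by
    intro h0'
    apply hfE00
    rw [hfE0Q, h0', zero_mul]
  have hh0val : 0 ≤ h0.valuation := by
    rw [hh0]
    exact PadicInt.valuation_coe_nonneg
  -- Step 6: the identity `h0 · ϖ′ · s · Tp² · (u₂ u₃)² = u₁ · 2^v · Shp` in `ℚ_2`
  have key : h0 * (ϖ' : ℚ_[2]) * (s : ℚ_[2]) * Tp ^ 2 *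
      (((u₂ : ℤ_[2]) : ℚ_[2]) * ((u₃ : ℤ_[2]) : ℚ_[2])) ^ 2 =
      ((u₁ : ℤ_[2]) : ℚ_[2]) * (2 : ℚ_[2]) ^ v * Shp := by
    apply mul_right_cancel₀ (pow_ne_zero 2 hNp0)
    calc h0 * (ϖ' : ℚ_[2]) * (s : ℚ_[2]) * Tp ^ 2 *
          (((u₂ : ℤ_[2]) : ℚ_[2]) * ((u₃ : ℤ_[2]) : ℚ_[2])) ^ 2 * Np ^ 2
        = (h0 * ((ϖ' : ℚ_[2]) * ((1 - a⁻¹) ^ 2 * (s : ℚ_[2])))) * Tp ^ 2 := by rw [h1]; ring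
      _ = ((PowerSeries.constantCoeff fE : ℤ_[2]) : ℚ_[2]) * Tp ^ 2 := by rw [← hfE0Q]
      _ = ((u₁ : ℤ_[2]) : ℚ_[2]) * (2 : ℚ_[2]) ^ v * Np ^ 2 *
            (Nat.card (W.selmerGroupPInfty 2) : ℚ_[2]) := hu₁
      _ = ((u₁ : ℤ_[2]) : ℚ_[2]) * (2 : ℚ_[2]) ^ v * Shp * Np ^ 2 := by rw [hSel']; ring
  -- Step 7: valuations
  have hv2 : (2 : ℚ_[2]).valuation = 1 := by
    have h2 : ((2 : ℕ) : ℚ_[2]).valuation = 1 := Padic.valuation_p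
    rwa [Nat.cast_ofNat] at h2
  have hvalL : (h0 * (ϖ' : ℚ_[2]) * (s : ℚ_[2]) * Tp ^ 2 *
      (((u₂ : ℤ_[2]) : ℚ_[2]) * ((u₃ : ℤ_[2]) : ℚ_[2])) ^ 2).valuation =
      h0.valuation + padicValRat 2 ϖ' + padicValRat 2 s + 2 * Tp.valuation := by
    rw [Padic.valuation_mul (mul_ne_zero (mul_ne_zero (mul_ne_zero hh0ne hϖ'Q0) hsQ0)
        (pow_ne_zero 2 hTp0)) (pow_ne_zero 2 hU0),
      Padic.valuation_mul (mul_ne_zero (mul_ne_zero hh0ne hϖ'Q0) hsQ0) (pow_ne_zero 2 hTp0),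
      Padic.valuation_mul (mul_ne_zero hh0ne hϖ'Q0) hsQ0, Padic.valuation_mul hh0ne hϖ'Q0,
      Padic.valuation_pow Tp, Padic.valuation_pow,
      Padic.valuation_mul (coe_units_ne_zero 2 u₂) (coe_units_ne_zero 2 u₃),
      valuation_coe_units_eq_zero, valuation_coe_units_eq_zero, Padic.valuation_ratCast,
      Padic.valuation_ratCast]
    push_cast
    ring
  have hvalR : (((u₁ : ℤ_[2]) : ℚ_[2]) * (2 : ℚ_[2]) ^ v * Shp).valuation = v + Shp.valuation := by
    rw [Padic.valuation_mul (mul_ne_zero (coe_units_ne_zero 2 u₁) (pow_ne_zero v h20)) hShp0,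
      Padic.valuation_mul (coe_units_ne_zero 2 u₁) (pow_ne_zero v h20), valuation_coe_units_eq_zero,
      Padic.valuation_pow, hv2]
    ring
  have hval := congrArg Padic.valuation key
  rw [hvalL, hvalR] at hval
  have hvT : Tp.valuation = (padicValNat 2 W.torsionOrder : ℤ) := by
    have h := congrArg Padic.valuation hu₄'
    rw [Padic.valuation_natCast, Padic.valuation_mul (coe_units_ne_zero 2 u₄) hTp0,
      valuation_coe_units_eq_zero, zero_add] at h
    exact h.symm
  have hvS : Shp.valuation = (padicValNat 2 W.shaOrder : ℤ) := by
    have h := congrArg Padic.valuation hSha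
    rw [Padic.valuation_natCast, Padic.valuation_mul (coe_units_ne_zero 2 u₅) hShp0,
      valuation_coe_units_eq_zero, zero_add] at h
    exact h.symm
  rw [hvT, hvS] at hval
  -- Step 8: Miller's currency `#Ш_an = t · #E(ℚ)² / ∏ c_ℓ`
  have ht0 : t ≠ 0 := mul_ne_zero hϖ0 hs0
  have hcard : (Nat.card W.toAffine.Point : ℚ) ≠ 0 := by
    exact_mod_cast (Nat.card_pos (α := W.toAffine.Point)).ne'
  have htam : (W.tamagawaProduct : ℚ) ≠ 0 := by
    exact_mod_cast (W.tamagawaProduct_pos_holds : 0 < W.tamagawaProduct).ne'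
  have hcardT : (Nat.card W.toAffine.Point : ℚ) = (W.torsionOrder : ℚ) := by
    exact_mod_cast (W.torsionOrder_eq_natCard_of_finite).symm
  refine ⟨t * (Nat.card W.toAffine.Point : ℚ) ^ 2 / (W.tamagawaProduct : ℚ), hshaAn, ?_⟩
  rw [padicValRat.div (mul_ne_zero ht0 (pow_ne_zero 2 hcard)) htam,
    padicValRat.mul ht0 (pow_ne_zero 2 hcard), padicValRat.pow, hcardT]
  simp only [padicValRat.of_nat, Nat.cast_ofNat]
  linarith

/-! ## §3 The typed Eisenstein half delivers `MissingLowerBoundAt W 2` on O1-go ∧ r0 -/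

/-- **The Eisenstein half at `2` ⇒ the SHARP LOWER half `MissingLowerBoundAt W 2`** on a rank-`0`
good-ordinary-`2` curve, granted Greenberg 4.1 at `2` (`hEC`, in print), modularity (`hmod`), GZK
(`hGZK`) and `X(E/ℚ_∞)` torsion for the cyclotomic data (`hX`; Kato 17.4 (1) at `2`, in print —
`kato_divisibility_allPrimes W 2` clause (1), see `…_of_kato`). No image hypothesis, no period input:
the Néron `ϖ` cancels (`ϖ′ = ϖ`, `k = 0`). [cite: Miller2011LMS, Def. 1.1]
[cite: GreenbergLNM1716, Thm. 4.1 (p. 102)] [cite: SkinnerUrban2014, Conj. 3.6.8 (p. 45) (shape)] -/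
theorem missingLowerBoundAt_two_of_eisenstein (hEC : TwoAdicEulerCharRankZero W 0)
    (hmod : nonempty_modularParametrizationData)
    (hGZK : rank_eq_analyticRank_of_analyticRank_le_one)
    (hX : ∀ (κ : ZpExtension ℚ 2) (γ : Field.absoluteGaloisGroup ℚ), κ.IsCyclotomic →
      κ.IsTopGenerator γ → IsCyclotomicVariable 2 γ → ∀ D : W.SelmerDualData κ γ, D.IsTorsion)
    (hr : W.analyticRank = 0) (hgo : GoodOrd W 2) (h : MainConjectureEisensteinDivisibilityAtTwo W) :
    MissingLowerBoundAt W 2 := by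
  have hord : IsOrdinaryAt W 2 := hgo
  haveI : NeZero (W.conductorNorm ℤ) := ⟨(W.conductorNorm_pos_holds).ne'⟩
  obtain ⟨Dm⟩ := hmod W
  have hf : IsNewformOf W Dm.f := Dm.isNewformOf
  have hL : W.entireLFunction 1 ≠ 0 :=
    (W.analyticRank_eq_zero_iff_holds hf.hasEntireLFunction).mp hr
  obtain ⟨ϖ, hϖpos, hϖeq, -⟩ := Dm.exists_rat_mul_realPeriodRat_eq_plusPeriod
  obtain ⟨κ, hκ, γ, hγ, hγ'⟩ := exists_isCyclotomic_isTopGenerator_isCyclotomicVariable_holds 2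
  obtain ⟨D⟩ := W.nonempty_selmerDualData_holds κ γ hγ
  obtain ⟨q, hq, hle⟩ := lowerBound_two_of_eisensteinDivisibility W hEC hGZK hord hL hκ hγ hγ' hf D
    (hX κ γ hκ hγ hγ' D) ϖ hϖeq hϖpos.ne' 0 (by simp)
    (fun fE hchar => h κ γ hκ hγ hγ' hord Dm.f hf ϖ hϖeq D fE hchar)
  exact ⟨q, hq, by simpa using hle⟩

/-- The same with `X` torsion supplied by Kato 17.4 (1) AT `2` (in print, parity-free, any image:
`kato_divisibility_allPrimes W 2`, clause (1)). [cite: Kato2004Asterisque, Thm. 17.4 (1) (p. 273)] -/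
theorem missingLowerBoundAt_two_of_eisenstein_of_kato (hEC : TwoAdicEulerCharRankZero W 0)
    (hmod : nonempty_modularParametrizationData)
    (hGZK : rank_eq_analyticRank_of_analyticRank_le_one)
    (h17 : ∀ [NeZero (W.conductorNorm ℤ)] (f : CuspForm (Gamma0 (W.conductorNorm ℤ)) 2),
      kato_divisibility_allPrimes W 2 (f := f))
    (hr : W.analyticRank = 0) (hgo : GoodOrd W 2) (h : MainConjectureEisensteinDivisibilityAtTwo W) :
    MissingLowerBoundAt W 2 := by
  have hord : IsOrdinaryAt W 2 := hgo
  haveI : NeZero (W.conductorNorm ℤ) := ⟨(W.conductorNorm_pos_holds).ne'⟩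
  obtain ⟨Dm⟩ := hmod W
  exact missingLowerBoundAt_two_of_eisenstein W hEC hmod hGZK
    (fun κ γ hκ hγ hγ' D => (h17 Dm.f κ γ hκ hγ hγ' hord Dm.isNewformOf D).1) hr hgo h

end Summit.BirchSwinnertonDyer.Rank1Residual.X5.O1

end
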